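import Mathlib
import HarnessLib
import Summits.NavierStokesRegularity.NavierStokesRegularity.Theorems.UnthreadedRigidityDoorUnthreadedRigidityTwoShellPowerLaw
import Summits.NavierStokesRegularity.NavierStokesRegularity.Theorems.UnthreadedRigidityDoorUnthreadedRigidityTwoShellWindowRigidityGap

/-!
# Route `UnthreadedRigidityDoor`, item `UnthreadedRigidity` (W2, stmt-NavierStokesRegularity-27585) — LINE g12-1 «CO-ZONAL» rung family:
# ★★ `TwoShellWindowRigidity 3 4` and `4 3` — the first CONSECUTIVE pair beyond `(1,2)`: quintic law `K⁵ = C·H³` and its nonexistence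

Prover file (engine-1 g74; `--supports stmt-NavierStokesRegularity-27585 --as helper`; route-independent imports).

For a consecutive opposite-parity two-shell window the sphere coefficients (`twoShell_sphere_coefficients`, p732222) give `b_L ≡ 0` for the TOP
shell (`L = l + 1`), hence the POWER LAW `K^{L+1} = C·H^{L−1}` (`powerLaw`, file `…TwoShellPowerLaw`); the window closes as soon as such profiles do
not exist.  Here, for `L = 4`:
* ★ `eq_zero_of_bL_eq_zero_of_nonpos_of_decay` — the SIGN-NEGATIVE branch in EVERY degree `L ≥ 1`, given the extra decay `|H| ≤ D·r^{−(3L+1)}` on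
  `[1,∞)`: es-p1's `cubicLaw_neg_case` argument on the first integral `E = L·H′² − (L+1)KH` (`r^{4(L+1)}E` non-decreasing, `> 0` from a point
  where `H ≠ 0`; mean value on `[R, 2R]` + decay make it `≤ A/R`);
* ★ `quinticLawNonexistence` — `L = 4`: an admissible analytic profile with `K⁵ = C·H³` on `(0,∞)` vanishes (`C > 0`: `KH ≥ 0`,
  `eq_zero_of_bL_eq_zero_even_of_nonneg_const`; `C = 0`: `K ≡ 0`; `C < 0`: `KH ≤ 0` and `|H|³ = |K|⁵/|C| = O(r^{−40})` gives the decay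
  `|H| ≤ D r^{−13}`, `13 = 3·4 + 1`);
* ★★ `twoShellWindowRigidity_three_four`, `twoShellWindowRigidity_four_three` — the rungs, by the composition of `…TwoShellWindowRigidityGap`
  with `amplitudeVanishing` replaced by the quintic law; the residual `linkedPairWindowRigidity_three_four / _four_three` a fortiori;
* ★★ `twoShellWindowRigidity_of_odd_sum` — the opposite-parity TABLE by name: gap `≥ 2` (p732884) ∨ `{1,2}` (p728070) ∨ `{3,4}` (here).
Why only `L = 4`: the one-step decay bootstrap `|H| = (|K|^{L+1}/|C|)^{1/(L−1)} = O(r^{−(L+4)(L+1)/(L−1)})` beats `r^{−(3L+1)}` exactly for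
`L ≤ 4`; consecutive pairs with top degree `≥ 5` stay OPEN (odd top: no sign from the power law; even top `≥ 6`, `C < 0`: sharper decay needed).

HONEST LABEL: RUNGS about SPECIAL hypothetical two-shell windows (the class is EMPTY) + elementary ODE lemmas; support for `UnthreadedRigidity`
(27585), which stays OPEN with the door Target, W2 and Navier–Stokes regularity; no summit statement is proved.  MODEL/rung work; 0 kit.  [folklore]
-/

noncomputable section

-- the summit and its single sub-problem share the name (CONVENTIONS §1), as in every Theorems file
set_option linter.dupNamespace false

namespace Summit.NavierStokesRegularity.NavierStokesRegularity.Theorems.UnthreadedRigidity.MixedPair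

open Set Function Filter Topology
open scoped RealInnerProductSpace
open Literature.Analysis Literature.Analysis.FluidPDE
open Literature.Analysis.UnboundedOperators (heatExtension)
open Summit.NavierStokesRegularity.NavierStokesRegularity.Theorems.UnthreadedRigidity.ProfileHorn (E3)
open Summit.NavierStokesRegularity.NavierStokesRegularity.Theorems.UnthreadedRigidity.VirialHorn
  (IsSolidHarmonic VirialAdmissible sepShellL vortAmpL strainAmpL exists_skew_ne_zero window_analyticOnNhd_slice)
open Summit.NavierStokesRegularity.NavierStokesRegularity.Theorems.UnthreadedRigidity.ThreadingJets (analyticOnNhd_vortAmpL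
  virialAdmissible_hasDerivAt_of_pos eq_zero_of_vortAmpL_eq_zero)
open Summit.NavierStokesRegularity.NavierStokesRegularity.Theorems.UnthreadedRigidity.CoZonal (twoShellL TwoShellWindowRigidity
  LinkedPairWindowRigidity)
open Summit.NavierStokesRegularity.NavierStokesRegularity.Theorems.UnthreadedRigidity.Persistence (singleShellWindowVanishes sepShellL_null_of_pos)

/-! ## §1 The sign-negative branch under extra decay -/

/-- ★ **NO ADMISSIBLE PROFILE WITH `b_L ≡ 0`, `K·H ≤ 0`, `K ≠ 0` WHEREVER `H ≠ 0`, AND DECAY `|H| ≤ D·r^{−(3L+1)}` on `[1,∞)`** (every degree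
`L ≥ 1`; es-p1's `cubicLaw_neg_case` is `L = 2`). [folklore] -/
theorem eq_zero_of_bL_eq_zero_of_nonpos_of_decay {L : ℕ} (hL : 1 ≤ L) {H : ℝ → ℝ} (hH : VirialAdmissible L H)
    (hHa : AnalyticOnNhd ℝ H (Set.Ioi 0))
    (hb : ∀ r : ℝ, 0 < r →
      (L : ℝ) / (2 * r) * (((L : ℝ) - 1) * vortAmpL L H r * deriv H r - ((L : ℝ) + 1) * deriv (vortAmpL L H) r * H r) = 0)
    (hsign : ∀ r : ℝ, 0 < r → vortAmpL L H r * H r ≤ 0) (hKne : ∀ r : ℝ, 0 < r → H r ≠ 0 → vortAmpL L H r ≠ 0)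
    {D : ℝ} (hD0 : 0 ≤ D) (hdec : ∀ s : ℝ, 1 ≤ s → |H s| ≤ D / s ^ (3 * L + 1)) : ∀ r : ℝ, 0 < r → H r = 0 := by
  set E : ℝ → ℝ := fun s => (L : ℝ) * deriv H s ^ 2 - ((L : ℝ) + 1) * (vortAmpL L H s * H s) with hE
  have hWd : ∀ r, 0 < r → HasDerivAt (fun s => s ^ (4 * (L + 1)) * E s)
      (-(4 * ((L : ℝ) + 1) ^ 2) * r ^ (4 * L + 3) * (vortAmpL L H r * H r)) r :=
    fun r hr => hasDerivAt_weighted_firstIntegral hL hHa hr (hb r hr)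
  -- `r^{4(L+1)}E` is non-decreasing on `(0,∞)`
  have hWmono : MonotoneOn (fun s => s ^ (4 * (L + 1)) * E s) (Ioi 0) := by
    apply monotoneOn_of_deriv_nonneg (convex_Ioi 0)
    · exact fun r hr => (hWd r hr).continuousAt.continuousWithinAt
    · rw [interior_Ioi]; exact fun r hr => (hWd r hr).differentiableAt.differentiableWithinAt
    · rw [interior_Ioi]; intro r hr
      have hr' : 0 < r := hr
      rw [(hWd r hr').deriv]
      have h1 : 0 ≤ -(vortAmpL L H r * H r) := by linarith [hsign r hr']
      have : -(4 * ((L : ℝ) + 1) ^ 2) * r ^ (4 * L + 3) * (vortAmpL L H r * H r)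
          = 4 * ((L : ℝ) + 1) ^ 2 * r ^ (4 * L + 3) * (-(vortAmpL L H r * H r)) := by ring
      rw [this]; positivity
  by_contra hne
  push Not at hne
  obtain ⟨r₀, hr₀, hH0⟩ := hne
  have hK0 : vortAmpL L H r₀ ≠ 0 := hKne r₀ hr₀ hH0
  -- `e₁ = r₀^{4(L+1)} E(r₀) > 0`
  have he1 : 0 < r₀ ^ (4 * (L + 1)) * E r₀ := by
    have hKH : vortAmpL L H r₀ * H r₀ < 0 :=
      lt_of_le_of_ne (hsign r₀ hr₀) (mul_ne_zero hK0 hH0)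
    have h1 : 0 < E r₀ := by
      have h3 : 0 ≤ (L : ℝ) * deriv H r₀ ^ 2 := by positivity
      have h4 : 0 < -(((L : ℝ) + 1) * (vortAmpL L H r₀ * H r₀)) := by
        rw [← mul_neg]; exact mul_pos (by positivity) (by linarith)
      show 0 < (L : ℝ) * deriv H r₀ ^ 2 - ((L : ℝ) + 1) * (vortAmpL L H r₀ * H r₀)
      linarith
    positivity
  obtain ⟨e₁, he₁⟩ : ∃ e : ℝ, e = r₀ ^ (4 * (L + 1)) * E r₀ := ⟨_, rfl⟩
  have he1' : 0 < e₁ := he₁ ▸ he1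
  -- decay of `K`
  obtain ⟨M, hM0, hM⟩ := decay_profile hH
  -- the radius `R`
  obtain ⟨A, hA⟩ : ∃ A : ℝ, A = (2 : ℝ) ^ (4 * (L + 1)) * (4 * (L : ℝ) * D ^ 2) + ((L : ℝ) + 1) * M * D := ⟨_, rfl⟩
  have hA0 : 0 ≤ A := by rw [hA]; positivity
  obtain ⟨R, hR⟩ : ∃ R : ℝ, R = max r₀ 1 + A / e₁ + 1 := ⟨_, rfl⟩
  have hAe : 0 ≤ A / e₁ := by positivity
  have hm1 := le_max_right r₀ 1
  have hm0 := le_max_left r₀ 1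
  have hR1 : 1 ≤ R := by rw [hR]; linarith only [hm1, hAe]
  have hRr₀ : r₀ ≤ R := by rw [hR]; linarith only [hm0, hAe]
  have hRA : A / e₁ < R := by rw [hR]; linarith only [hm1, hAe]
  have hR0 : 0 < R := lt_of_lt_of_le one_pos hR1
  -- mean value theorem on `[R, 2R]`
  have hcont : ContinuousOn H (Icc R (2 * R)) := hHa.continuousOn.mono fun s hs => lt_of_lt_of_le hR0 hs.1
  have hdiff : DifferentiableOn ℝ H (Ioo R (2 * R)) := hHa.differentiableOn.mono fun s hs => lt_trans hR0 hs.1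
  obtain ⟨ξ, hξ, hξd⟩ := exists_deriv_eq_slope H (by linarith only [hR0] : R < 2 * R) hcont hdiff
  have hξR : R ≤ ξ := hξ.1.le
  have hξ2R : ξ ≤ 2 * R := hξ.2.le
  have hξ1 : 1 ≤ ξ := hR1.trans hξR
  have hξ0 : 0 < ξ := lt_of_lt_of_le one_pos hξ1
  have hξr₀ : r₀ ≤ ξ := hRr₀.trans hξR
  -- lower bound at `ξ`
  have hlow : e₁ ≤ ξ ^ (4 * (L + 1)) * E ξ := he₁ ▸ hWmono (mem_Ioi.2 hr₀) (mem_Ioi.2 hξ0) hξr₀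
  -- upper bound for `H′(ξ)²`
  have hH' : deriv H ξ ^ 2 ≤ 4 * D ^ 2 / R ^ (6 * L + 4) := by
    rw [hξd]
    have h1 : |H (2 * R) - H R| ≤ 2 * (D / R ^ (3 * L + 1)) := by
      have h2 := hdec R hR1
      have h3 := hdec (2 * R) (by linarith only [hR1])
      have h4 : D / (2 * R) ^ (3 * L + 1) ≤ D / R ^ (3 * L + 1) := by
        apply div_le_div_of_nonneg_left hD0 (by positivity)
        gcongr; linarith only [hR0]
      calc |H (2 * R) - H R| ≤ |H (2 * R)| + |H R| := abs_sub _ _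
        _ ≤ 2 * (D / R ^ (3 * L + 1)) := by linarith only [h2, h3, h4]
    have h5 : (H (2 * R) - H R) ^ 2 ≤ (2 * (D / R ^ (3 * L + 1))) ^ 2 := by
      rw [← sq_abs]; exact pow_le_pow_left₀ (abs_nonneg _) h1 2
    have h6 : 2 * R - R = R := by ring
    rw [h6, div_pow]
    calc (H (2 * R) - H R) ^ 2 / R ^ 2 ≤ (2 * (D / R ^ (3 * L + 1))) ^ 2 / R ^ 2 := by gcongr
      _ = 4 * D ^ 2 / R ^ (6 * L + 4) := by field_simp; ring
  -- the two pieces of `ξ^{4(L+1)} E ξ`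
  have t1 : ξ ^ (4 * (L + 1)) * ((L : ℝ) * deriv H ξ ^ 2) ≤ (2 : ℝ) ^ (4 * (L + 1)) * (4 * (L : ℝ) * D ^ 2) / R := by
    have h1 : ξ ^ (4 * (L + 1)) ≤ (2 * R) ^ (4 * (L + 1)) := pow_le_pow_left₀ hξ0.le hξ2R _
    calc ξ ^ (4 * (L + 1)) * ((L : ℝ) * deriv H ξ ^ 2)
        ≤ (2 * R) ^ (4 * (L + 1)) * ((L : ℝ) * (4 * D ^ 2 / R ^ (6 * L + 4))) := by gcongr
      _ = (2 : ℝ) ^ (4 * (L + 1)) * (4 * (L : ℝ) * D ^ 2) / R ^ (2 * L) := by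
          rw [mul_pow]; field_simp; ring
      _ ≤ (2 : ℝ) ^ (4 * (L + 1)) * (4 * (L : ℝ) * D ^ 2) / R := by
          apply div_le_div_of_nonneg_left (by positivity) hR0
          calc R = R ^ 1 := (pow_one R).symm
            _ ≤ R ^ (2 * L) := pow_le_pow_right₀ hR1 (by omega)
  have t2 : ξ ^ (4 * (L + 1)) * (-(((L : ℝ) + 1) * (vortAmpL L H ξ * H ξ))) ≤ ((L : ℝ) + 1) * M * D / R := by
    obtain ⟨-, -, hKξ⟩ := hM ξ hξ1
    have hHξ := hdec ξ hξ1
    have h1 : -(vortAmpL L H ξ * H ξ) ≤ M / ξ ^ (L + 4) * (D / ξ ^ (3 * L + 1)) := by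
      calc -(vortAmpL L H ξ * H ξ) ≤ |vortAmpL L H ξ * H ξ| := neg_le_abs _
        _ = |vortAmpL L H ξ| * |H ξ| := abs_mul _ _
        _ ≤ M / ξ ^ (L + 4) * (D / ξ ^ (3 * L + 1)) := mul_le_mul hKξ hHξ (abs_nonneg _) (by positivity)
    calc ξ ^ (4 * (L + 1)) * (-(((L : ℝ) + 1) * (vortAmpL L H ξ * H ξ)))
        = ((L : ℝ) + 1) * (ξ ^ (4 * (L + 1)) * (-(vortAmpL L H ξ * H ξ))) := by ring
      _ ≤ ((L : ℝ) + 1) * (ξ ^ (4 * (L + 1)) * (M / ξ ^ (L + 4) * (D / ξ ^ (3 * L + 1)))) := by gcongr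
      _ = ((L : ℝ) + 1) * M * D / ξ := by
          field_simp
          ring
      _ ≤ ((L : ℝ) + 1) * M * D / R := div_le_div_of_nonneg_left (by positivity) hR0 hξR
  have hup : ξ ^ (4 * (L + 1)) * E ξ ≤ A / R := by
    have expand : ξ ^ (4 * (L + 1)) * E ξ
        = ξ ^ (4 * (L + 1)) * ((L : ℝ) * deriv H ξ ^ 2) + ξ ^ (4 * (L + 1)) * (-(((L : ℝ) + 1) * (vortAmpL L H ξ * H ξ))) := by
      show ξ ^ (4 * (L + 1)) * ((L : ℝ) * deriv H ξ ^ 2 - ((L : ℝ) + 1) * (vortAmpL L H ξ * H ξ)) = _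
      ring
    rw [expand, hA, add_div]
    exact add_le_add t1 t2
  -- contradiction
  have hfin : A / R < e₁ := by
    rw [div_lt_iff₀ hR0]
    have h1 := hRA
    rw [div_lt_iff₀ he1'] at h1
    linarith only [h1]
  linarith only [hlow, hup, hfin]

/-! ## §2 The quintic law `K⁵ = C·H³` (`L = 4`) has no admissible solution -/

/-- ★ **QUINTIC-LAW NONEXISTENCE** (`L = 4`): a virial-admissible degree-4 profile, real-analytic on `(0,∞)`, with `b₄[H] ≡ 0` vanishes on `(0,∞)`
(power law `K⁵ = C·H³`; `C > 0`: sign-definite branch; `C = 0`: `K ≡ 0`; `C < 0`: decay `|H| ≤ D r^{−13}` from `|H|³ = |K|⁵/|C|`, negative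
branch). [folklore] -/
theorem quinticLawNonexistence {H : ℝ → ℝ} (hH : VirialAdmissible 4 H) (hHa : AnalyticOnNhd ℝ H (Set.Ioi 0))
    (hb : ∀ r : ℝ, 0 < r →
      ((4 : ℕ) : ℝ) / (2 * r) * ((((4 : ℕ) : ℝ) - 1) * vortAmpL 4 H r * deriv H r - (((4 : ℕ) : ℝ) + 1) * deriv (vortAmpL 4 H) r * H r) = 0) :
    ∀ r : ℝ, 0 < r → H r = 0 := by
  obtain ⟨C, hKC⟩ := powerLaw 2 H hH hHa hb
  rcases lt_trichotomy C 0 with hC0 | hC0 | hC0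
  · -- `C < 0`: `KH ≤ 0`, `K ≠ 0` where `H ≠ 0`, decay `|H| ≤ D / r^{13}`
    have hsign : ∀ r : ℝ, 0 < r → vortAmpL 4 H r * H r ≤ 0 := by
      intro r hr
      have h := hKC r hr
      set K := vortAmpL 4 H r
      set y := H r
      by_contra hpos
      push Not at hpos
      have h1 : 0 < (K * y) ^ 3 * K ^ 2 := by
        have hK : K ≠ 0 := by rintro h0; rw [h0, zero_mul] at hpos; exact lt_irrefl 0 hpos
        positivity
      have h2 : (K * y) ^ 3 * K ^ 2 = C * y ^ 3 * y ^ 3 := by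
        rw [show (K * y) ^ 3 * K ^ 2 = K ^ (2 + 3) * y ^ (2 + 1) by ring, h]
      have h3 : C * y ^ 3 * y ^ 3 = C * (y ^ 3) ^ 2 := by ring
      rw [h2, h3] at h1
      have h4 : C * (y ^ 3) ^ 2 ≤ 0 := mul_nonpos_of_nonpos_of_nonneg hC0.le (by positivity)
      linarith
    have hKne : ∀ r : ℝ, 0 < r → H r ≠ 0 → vortAmpL 4 H r ≠ 0 := by
      intro r hr hHr hK0
      have h := hKC r hr
      rw [hK0, zero_pow (by norm_num)] at h
      have : H r ^ (2 + 1) = 0 := by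
        have h2 : C * H r ^ (2 + 1) = 0 := h.symm
        exact (mul_eq_zero.mp h2).resolve_left hC0.ne
      exact hHr (pow_eq_zero_iff (by norm_num) |>.mp this)
    obtain ⟨M, hM0, hM⟩ := decay_profile hH
    -- `D³ = M⁵/|C|`
    set c : ℝ := -C with hc
    have hc0 : 0 < c := by rw [hc]; linarith
    set D : ℝ := (M ^ 5 / c) ^ ((3 : ℝ)⁻¹) with hD
    have hD0 : 0 ≤ D := Real.rpow_nonneg (by positivity) _
    have hD3 : D ^ 3 = M ^ 5 / c := by
      rw [hD]
      exact Real.rpow_inv_natCast_pow (by positivity) (by norm_num)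
    have hdec : ∀ s : ℝ, 1 ≤ s → |H s| ≤ D / s ^ (3 * 4 + 1) := by
      intro s hs
      have hs0 : 0 < s := lt_of_lt_of_le one_pos hs
      obtain ⟨-, -, hKs⟩ := hM s hs
      have h1 : |H s| ^ 3 = |vortAmpL 4 H s| ^ 5 / c := by
        have h2 := hKC s hs0
        have h3 : |vortAmpL 4 H s| ^ 5 = |C| * |H s| ^ 3 := by
          rw [← abs_pow, show (5 : ℕ) = 2 + 3 by norm_num, h2, abs_mul, abs_pow]
        rw [h3, abs_of_neg hC0, ← hc]
        field_simp
      have h4 : |H s| ^ 3 ≤ (D / s ^ 13) ^ 3 := by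
        rw [h1, div_pow, hD3]
        calc |vortAmpL 4 H s| ^ 5 / c ≤ (M / s ^ (4 + 4)) ^ 5 / c := by gcongr
          _ = M ^ 5 / c / s ^ 40 := by rw [div_pow, ← pow_mul]; ring
          _ ≤ M ^ 5 / c / (s ^ 13) ^ 3 := by
              apply div_le_div_of_nonneg_left (by positivity) (by positivity)
              rw [← pow_mul]
              exact pow_le_pow_right₀ hs (by norm_num)
      exact (pow_le_pow_iff_left₀ (abs_nonneg _) (by positivity) (by norm_num)).mp h4
    exact eq_zero_of_bL_eq_zero_of_nonpos_of_decay (L := 4) (by norm_num) hH hHa (fun r hr => by exact_mod_cast hb r hr) hsign hKne hD0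
      hdec
  · -- `C = 0`: `K ≡ 0`
    subst hC0
    have hK : ∀ r : ℝ, 0 < r → vortAmpL 4 H r = 0 := fun r hr => by
      have h1 := hKC r hr
      rw [zero_mul] at h1
      exact (pow_eq_zero_iff (by norm_num)).1 h1
    exact fun r hr => (eq_zero_of_vortAmpL_eq_zero hH hK r hr).1
  · -- `C > 0`
    exact eq_zero_of_bL_eq_zero_even_of_nonneg_const 1 hH hHa (fun r hr => by exact_mod_cast hb r hr) hC0.le
      (fun r hr => by exact_mod_cast hKC r hr)

/-! ## §3 ★★ The rungs `(3,4)` and `(4,3)` -/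

variable {S : Set ℝ} {u : ℝ → E3 → E3} {x₀ : E3}

/-- ★ **TWO-SHELL WINDOWS OF DEGREES `(3,4)` VANISH**: the top (even) profile has `b₄ ≡ 0` (`twoShell_sphere_coefficients`), hence is null by the
quintic law, and single-shell windows vanish. -/
theorem twoShell_window_vanishes_three_four (hS : IsOpen S) (hcont : ContinuousOn (uncurry u) (S ×ˢ univ))
    (hdiv : ∀ t ∈ S, VectorCalculus.IsDivFree (u t))
    (hmild : ∀ s ∈ S, ∀ t ∈ S, s < t → ∀ x, u t x = heatExtension (u s) (t - s) x - oseenDuhamel 1 s u u t x)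
    (hbdd : ∀ τ ∈ S, ∃ B : ℝ, ∀ t ∈ S, t ≤ τ → ∀ x, ‖u t x‖ ≤ B)
    {Y₁ Y₂ : E3 → ℝ} (hY₁ : IsSolidHarmonic 3 Y₁) (hY₂ : IsSolidHarmonic 4 Y₂) (hY₁ne : ∃ y, Y₁ y ≠ 0) (hY₂ne : ∃ y, Y₂ y ≠ 0)
    {H₁f H₂f : ℝ → ℝ → ℝ} (hH₁ : ∀ t ∈ S, VirialAdmissible 3 (H₁f t)) (hH₂ : ∀ t ∈ S, VirialAdmissible 4 (H₂f t))
    (hshape : ∀ t ∈ S, u t = twoShellL (H₁f t) (H₂f t) Y₁ Y₂ x₀) :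
    ∀ t ∈ S, ∀ x, u t x = 0 := by
  have hl₁ : Odd 3 := by decide
  have hl₂ : Even 4 := by decide
  have hH₂null : ∀ t ∈ S, ∀ r : ℝ, 0 < r → H₂f t r = 0 := by
    intro t ht
    have hbal := twoShell_window_toroidal_balance hS hcont hdiv hmild hbdd hl₁ hl₂ hY₁ hY₂ hH₁ hH₂ hshape ht
    rw [hshape t ht] at hbal
    have han : AnalyticOnNhd ℝ (twoShellL (H₁f t) (H₂f t) Y₁ Y₂ x₀) univ := by
      rw [← hshape t ht]; exact window_analyticOnNhd_slice hS hcont hmild hbdd ht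
    have hA2 : AnalyticOnNhd ℝ (H₂f t) (Ioi 0) :=
      analyticOnNhd_twoShellProfile_even hl₁ hl₂ (by norm_num) (by norm_num) hY₁ hY₂ hY₂ne (hH₁ t ht) (hH₂ t ht) han
    refine quinticLawNonexistence (hH₂ t ht) hA2 fun r hr => ?_
    obtain ⟨e, C, hrel⟩ := twoShell_sphere_relation hl₁ hl₂ (by norm_num) (by norm_num) hY₁ hY₂ (hH₁ t ht) (hH₂ t ht) x₀ hbal hr
    have hcoef := twoShell_sphere_coefficients (Y_T := Y₂) (Y_B := Y₁) (L := 4) (ℓ := 3) (by norm_num) (by norm_num) hY₂ hY₁ hY₂ne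
      (A_T := -(vortAmpL 4 (H₂f t) r * strainAmpL 4 (H₂f t) r) * (r ^ ((4 : ℤ) - 1)) ^ 2)
      (B_T := (4 : ℝ) / (2 * r) * (((4 : ℝ) - 1) * vortAmpL 4 (H₂f t) r * deriv (H₂f t) r
          - ((4 : ℝ) + 1) * deriv (vortAmpL 4 (H₂f t)) r * H₂f t r) * (r ^ 4) ^ 2)
      (A_B := -(vortAmpL 3 (H₁f t) r * strainAmpL 3 (H₁f t) r) * (r ^ ((3 : ℤ) - 1)) ^ 2)
      (B_B := (3 : ℝ) / (2 * r) * (((3 : ℝ) - 1) * vortAmpL 3 (H₁f t) r * deriv (H₁f t) r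
          - ((3 : ℝ) + 1) * deriv (vortAmpL 3 (H₁f t)) r * H₁f t r) * (r ^ 3) ^ 2)
      (E_T := -(e * r ^ 4)) (E_B := 0) (C₀ := C) (Or.inr hl₂) (Or.inl rfl)
      (fun w hw => by have h := hrel w hw; push_cast at h ⊢; linear_combination h)
    have hB := hcoef.1
    have hpow : (r ^ 4) ^ 2 ≠ 0 := by positivity
    have h1 := (mul_eq_zero.mp hB).resolve_right hpow
    push_cast
    linear_combination h1
  have hshape' : ∀ t ∈ S, u t = sepShellL (H₁f t) Y₁ x₀ := by
    intro t ht
    rw [hshape t ht]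
    funext x
    show sepShellL (H₁f t) Y₁ x₀ x + sepShellL (H₂f t) Y₂ x₀ x = _
    rw [sepShellL_null_of_pos (H₂f t) Y₂ x₀ (hH₂null t ht) x, add_zero]
  exact singleShellWindowVanishes 3 (by norm_num) S hS u x₀ hcont hdiv hmild hbdd Y₁ H₁f hY₁ hY₁ne hH₁ hshape'

/-- ★★ **`TwoShellWindowRigidity 3 4` HOLDS.** -/
theorem twoShellWindowRigidity_three_four : TwoShellWindowRigidity 3 4 := by
  intro S hS _ u x₀ hcont hdiv hmild hbdd _ Y₁ Y₂ H₁f H₂f hY₁ hY₂ hY₁ne hY₂ne hH₁ hH₂ hshape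
  have hzero := twoShell_window_vanishes_three_four hS hcont hdiv hmild hbdd hY₁ hY₂ hY₁ne hY₂ne hH₁ hH₂ hshape
  obtain ⟨A, hskew, hA0⟩ := exists_skew_ne_zero
  refine ⟨A, hskew, hA0, fun t ht x => ?_⟩
  have hut : u t = fun _ => (0 : E3) := funext (hzero t ht)
  rw [hut]
  simp

/-- ★★ **`TwoShellWindowRigidity 4 3` HOLDS** (the summands swapped). -/
theorem twoShellWindowRigidity_four_three : TwoShellWindowRigidity 4 3 := by
  intro S hS hconn u x₀ hcont hdiv hmild hbdd hunth Y₂ Y₁ H₂f H₁f hY₂ hY₁ hY₂ne hY₁ne hH₂ hH₁ hshape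
  refine twoShellWindowRigidity_three_four S hS hconn u x₀ hcont hdiv hmild hbdd hunth Y₁ Y₂ H₁f H₂f hY₁ hY₂ hY₁ne hY₂ne hH₁ hH₂
    fun t ht => ?_
  rw [hshape t ht]
  funext x
  simp only [twoShellL]
  rw [add_comm]

/-- ★★ **THE OPPOSITE-PARITY TABLE BY NAME**: `TwoShellWindowRigidity l₁ l₂` for every pair of degrees `≥ 1` of opposite parity that is NOT a
consecutive pair `(l, l+1)`/`(l+1, l)` with `l ≥ 2` other than `{3,4}` — i.e. gap `≥ 2` (p732884), `{1,2}` (p728070), `{3,4}` (this file). -/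
theorem twoShellWindowRigidity_of_odd_sum {l₁ l₂ : ℕ} (hd₁ : 1 ≤ l₁) (hd₂ : 1 ≤ l₂) (hodd : Odd (l₁ + l₂))
    (hcase : l₁ + 2 ≤ l₂ ∨ l₂ + 2 ≤ l₁ ∨ l₁ + l₂ = 3 ∨ l₁ + l₂ = 7) : TwoShellWindowRigidity l₁ l₂ := by
  have hpar : (Odd l₁ ∧ Even l₂) ∨ (Even l₁ ∧ Odd l₂) := by
    rcases Nat.even_or_odd l₁ with h1 | h1
    · right
      refine ⟨h1, ?_⟩
      rcases Nat.even_or_odd l₂ with h2 | h2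
      · exact absurd hodd (Nat.not_odd_iff_even.mpr (h1.add h2))
      · exact h2
    · left
      refine ⟨h1, ?_⟩
      rcases Nat.even_or_odd l₂ with h2 | h2
      · exact h2
      · exact absurd hodd (Nat.not_odd_iff_even.mpr (h1.add_odd h2))
  by_cases hgap : l₁ + 2 ≤ l₂ ∨ l₂ + 2 ≤ l₁
  · exact twoShellWindowRigidity_of_gap hd₁ hd₂ hpar hgap
  · have hsum : l₁ + l₂ = 3 ∨ l₁ + l₂ = 7 := by
      rcases hcase with h | h | h | h
      · exact absurd (Or.inl h) hgap
      · exact absurd (Or.inr h) hgap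
      · exact Or.inl h
      · exact Or.inr h
    -- the four consecutive pairs `(1,2)`, `(2,1)`, `(3,4)`, `(4,3)`
    have hne : l₁ ≠ l₂ := fun h => by rw [h, ← two_mul] at hodd; exact Nat.not_odd_iff_even.mpr (even_two_mul _) hodd
    rcases hsum with h | h
    · rcases Nat.lt_or_gt_of_ne hne with h12 | h12
      · obtain ⟨rfl, rfl⟩ : l₁ = 1 ∧ l₂ = 2 := by omega
        exact twoShellWindowRigidity_one_two
      · obtain ⟨rfl, rfl⟩ : l₁ = 2 ∧ l₂ = 1 := by omega
        exact twoShellWindowRigidity_two_one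
    · rcases Nat.lt_or_gt_of_ne hne with h12 | h12
      · obtain ⟨rfl, rfl⟩ : l₁ = 3 ∧ l₂ = 4 := by omega
        exact twoShellWindowRigidity_three_four
      · obtain ⟨rfl, rfl⟩ : l₁ = 4 ∧ l₂ = 3 := by omega
        exact twoShellWindowRigidity_four_three

/-- the residual R of LINE g12-1 at `(3,4)` holds a fortiori. -/
theorem linkedPairWindowRigidity_three_four : LinkedPairWindowRigidity 3 4 :=
  fun S hS hc u x₀ h1 h2 h3 h4 h5 Y₁ Y₂ H₁f H₂f hY₁ hY₂ hn₁ hn₂ _ hH₁ hH₂ hsh _ =>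
    twoShellWindowRigidity_three_four S hS hc u x₀ h1 h2 h3 h4 h5 Y₁ Y₂ H₁f H₂f hY₁ hY₂ hn₁ hn₂ hH₁ hH₂ hsh

/-- the residual R at `(4,3)`. -/
theorem linkedPairWindowRigidity_four_three : LinkedPairWindowRigidity 4 3 :=
  fun S hS hc u x₀ h1 h2 h3 h4 h5 Y₁ Y₂ H₁f H₂f hY₁ hY₂ hn₁ hn₂ _ hH₁ hH₂ hsh _ =>
    twoShellWindowRigidity_four_three S hS hc u x₀ h1 h2 h3 h4 h5 Y₁ Y₂ H₁f H₂f hY₁ hY₂ hn₁ hn₂ hH₁ hH₂ hsh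

end Summit.NavierStokesRegularity.NavierStokesRegularity.Theorems.UnthreadedRigidity.MixedPair

end
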